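import Summits.Ventures.CertifiedArithmetic.Expansions.IncircleExact
import Mathlib.Tactic.Linarith
import Mathlib.Tactic.Ring
import Mathlib.Tactic.NormNum

/-!
# INSPHERE exactly, in weakly nonoverlapping expansion arithmetic

NEW WORK of this development (ENGINES group, unit `eng-quad-4`; HONEST FRAMING: shared numerical
engines serving client cells; rigour lives in the verifiers; every published number belongs to a
client cell's ledger, not to the engines group).  Not a published result, hence under
`Summits/Ventures/` with no citation tag of its own.  The fourth of Shewchuk's predicates
[Shewchuk1997, §4.4]: INSPHERE(a, b, c, d, e) is the sign of the `4 × 4` determinant with rows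
`(a − e, |a − e|²)`, …, `(d − e, |d − e|²)` — positive iff `e` lies inside the sphere through
`a, b, c, d` when ORIENT3D(a, b, c, d) is positive [Shewchuk1997, eq. (9) p. 345; eq. (8) is the
untranslated `5 × 5` form with rows `(x, y, z, x² + y² + z², 1)`, "equivalent … with a little more
effort"].  For INSPHERE — unlike the other three predicates — Shewchuk's own stage D "is not
computed incrementally from B; rather, if C is not accurate enough, D is computed from scratch"
[p. 352; Table 7 p. 353, row "Adaptive D (8), exact"], i.e. by an exact evaluation of form (8) such
as the one below.  This file is a cofactor scheme IN THE MANNER OF the exact routine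
`insphereexact` of the public-domain `predicates.c` (whose text we do not hold): the levels —
`xy`-minor blocks, `3 × 3` minors by SCALE-EXPANSION, `4 × 4` minors by FAST-EXPANSION-SUM, lifts
by two SCALE-EXPANSIONs per coordinate, at most 5760 components — are those of that routine as we
understand it; the grouping inside each level, the placement of the signs and the recomputation
of shared blocks (pure functions, the same numbers) are OURS.  The definitions below are what the
theorems are about; nothing is claimed about the C code itself.

THE SCHEME (`insphereExact`), on the fifteen coordinates as they are (no differences): the `5 × 5`
determinant with rows `(x, y, z, x² + y² + z², 1)` is expanded along the lift column,
`−|a|²·N_a + |b|²·N_b − |c|²·N_c + |d|²·N_d − |e|²·N_e`, where `N_a` is the `4 × 4` determinant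
of the rows `(x, y, z, 1)` of `b, c, d, e` (in this order), etc.; each `N` is expanded along its
column of ones into four `3 × 3` minors `T(p, q, r) = p₃·qr − q₃·pr + r₃·pq` of `xy`-blocks
`pq = p₁ ⊗ q₂ − q₁ ⊗ p₂` (`insphereMinor3`: three SCALE-EXPANSIONs of blocks, two sums, ≤ 24
components; `insphereMinor4 = (T(pqr) ⊞ T(prs)) ⊞ −(T(qrs) ⊞ T(pqs))`, ≤ 96), and a lift
`|a|²·N` is `((N ⊗ a₁) ⊗ s ⊞ (N ⊗ a₂) ⊗ t) ⊞ (N ⊗ a₃) ⊗ u` with `(s, t, u) = ±(a₁, a₂, a₃)`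
carrying the sign (`insphereLift`, ≤ 1152); finally
`deter = ((L_a ⊞ L_b) ⊞ (L_c ⊞ L_d)) ⊞ L_e` (≤ 5760) and the answer is the sign of its last
component.  All sums are FAST-EXPANSION-SUMs and all scalings SCALE-EXPANSIONs, with zero
elimination.

WHAT IS PROVED (`p ≥ 4`; `fl` any round-to-nearest into `F(p, emin)` with `RoundoffBelow 2` — e.g.
ties-to-even; `tp` a two-product error-free on `F(p, ke₀) × F(p, e₀)` for `k = 1, 2, 3, 4`; the
fifteen coordinates in `F(p, e₀)` with `ke₀ ≥ emin` for `k = 2, …, 5`, i.e. no product of five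
coordinates' worth of magnitude underflows):
* `insphereExact_spec` — `deter` is a NONEMPTY weakly nonoverlapping expansion of at most 5760
  floats, all nonzero unless it is `⟨0⟩`, whose sum is `insphereDet a b c d e` EXACTLY (form
  (8) expanded by cofactors equals form (9) identically — the "little more effort" is `ring`;
  `insphereDet` is written, like `orient3dDet` and `incircleDet` of the stage-A files, as the
  cofactor expansion `|d−e|²·T(a', b', c') − |c−e|²·T(d', a', b') + |b−e|²·T(c', d', a')
  − |a−e|²·T(b', c', d')` of the translated points — the form `predicates.c`'s `insphere` filter
  evaluates, as we understand it).
* `insphereExact_sign` — the last component decides: `det > 0 ↔ last > 0`, `det < 0 ↔ last < 0`,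
  `det = 0 ↔ deter = ⟨0⟩`.
* `insphereExactRNE_correct` — IEEE round-to-nearest-even with the FMA two-product (binary64: all
  coordinates multiples of `2^−214`).
Tools: `ExactW` and its lemmas (`Orient3dExact.lean`, `IncircleExact.lean`).

HONEST SCOPE.  (1) Exact routine only; stages A–C of the adaptive `insphere` (whose error
bounds the paper does not print — §4.4 gives Tables 3 and 5 for ORIENT3D and INCIRCLE only) are
not formalised in this library yet.  (2) Model conventions as in `Orient2d.lean` (zero elimination
as a post-pass, merge order on ties, TWO-TWO-DIFF as EXPANSION-SUM, no overflow model; `F(p, e₀)`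
with `5e₀ ≥ emin` excludes the gradual-underflow range).  (3) The component bounds are structural;
no claim that they are attained.  (4) The cofactor identity and the sign pattern were checked on
random rational inputs before being proved by `ring`.

Reference for the predicate and the algorithm's design: J. R. Shewchuk, Discrete Comput. Geom. 18
(1997) 305–363, §2.8, §4.1, §4.4, and `predicates.c` (`insphereexact`) [Shewchuk1997].
-/

namespace Summit.Ventures.CertifiedArithmetic.Expansions

open Literature.ComputerArithmetic.JeannerodRump2018
open Literature.ComputerArithmetic.BoldoJeannerodMelquiondMuller2023 hiding twoSum twoSum_fst
  isFloat_twoSum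
open Literature.ComputerArithmetic.Shewchuk1997

variable {p : ℕ} {emin : ℤ} {fl : ℚ → ℚ}

/-! ## The determinants -/

/-- The `3 × 3` determinant of the rows `(p₁, p₂, p₃)`, `(q₁, q₂, q₃)`, `(r₁, r₂, r₃)`, expanded
along the third column: `p₃·(q₁r₂ − r₁q₂) − q₃·(p₁r₂ − r₁p₂) + r₃·(p₁q₂ − q₁p₂)`. -/
def xyzDet3 (p₁ p₂ p₃ q₁ q₂ q₃ r₁ r₂ r₃ : ℚ) : ℚ :=
  p₃ * (q₁ * r₂ - r₁ * q₂) - q₃ * (p₁ * r₂ - r₁ * p₂) + r₃ * (p₁ * q₂ - q₁ * p₂)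

/-- **The INSPHERE determinant** [Shewchuk1997, §4.4]: the `4 × 4` determinant with rows
`(a − e, |a − e|²)`, `(b − e, |b − e|²)`, `(c − e, |c − e|²)`, `(d − e, |d − e|²)`, expanded along
the lift column. -/
def insphereDet (a₁ a₂ a₃ b₁ b₂ b₃ c₁ c₂ c₃ d₁ d₂ d₃ e₁ e₂ e₃ : ℚ) : ℚ :=
  ((d₁ - e₁) * (d₁ - e₁) + (d₂ - e₂) * (d₂ - e₂) + (d₃ - e₃) * (d₃ - e₃))
      * xyzDet3 (a₁ - e₁) (a₂ - e₂) (a₃ - e₃) (b₁ - e₁) (b₂ - e₂) (b₃ - e₃)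
          (c₁ - e₁) (c₂ - e₂) (c₃ - e₃)
    - ((c₁ - e₁) * (c₁ - e₁) + (c₂ - e₂) * (c₂ - e₂) + (c₃ - e₃) * (c₃ - e₃))
      * xyzDet3 (d₁ - e₁) (d₂ - e₂) (d₃ - e₃) (a₁ - e₁) (a₂ - e₂) (a₃ - e₃)
          (b₁ - e₁) (b₂ - e₂) (b₃ - e₃)
    + ((b₁ - e₁) * (b₁ - e₁) + (b₂ - e₂) * (b₂ - e₂) + (b₃ - e₃) * (b₃ - e₃))
      * xyzDet3 (c₁ - e₁) (c₂ - e₂) (c₃ - e₃) (d₁ - e₁) (d₂ - e₂) (d₃ - e₃)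
          (a₁ - e₁) (a₂ - e₂) (a₃ - e₃)
    - ((a₁ - e₁) * (a₁ - e₁) + (a₂ - e₂) * (a₂ - e₂) + (a₃ - e₃) * (a₃ - e₃))
      * xyzDet3 (b₁ - e₁) (b₂ - e₂) (b₃ - e₃) (c₁ - e₁) (c₂ - e₂) (c₃ - e₃)
          (d₁ - e₁) (d₂ - e₂) (d₃ - e₃)

/-! ## The levels of the scheme -/

/-- A `3 × 3` minor `T(p, q, r) = (qr ⊗ p₃ ⊞ pr ⊗ (−q₃)) ⊞ pq ⊗ r₃` over the `xy`-blocks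
`pq = p₁ ⊗ q₂ − q₁ ⊗ p₂` (≤ 24 components). -/
def insphereMinor3 (tp : ℚ → ℚ → ℚ × ℚ) (fl : ℚ → ℚ) (p₁ p₂ p₃ q₁ q₂ q₃ r₁ r₂ r₃ : ℚ) :
    List ℚ :=
  fastExpansionSumZeroElim fl
    (fastExpansionSumZeroElim fl
      (scaleExpansionZeroElim tp fl (twoTwoProdDiff tp fl q₁ r₂ r₁ q₂) p₃)
      (scaleExpansionZeroElim tp fl (twoTwoProdDiff tp fl p₁ r₂ r₁ p₂) (-q₃)))
    (scaleExpansionZeroElim tp fl (twoTwoProdDiff tp fl p₁ q₂ q₁ p₂) r₃)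

/-- A `4 × 4` minor of the rows `(x, y, z, 1)` of `p, q, r, s`:
`N(p, q, r, s) = (T(pqr) ⊞ T(prs)) ⊞ −(T(qrs) ⊞ T(pqs))` (≤ 96 components). -/
def insphereMinor4 (tp : ℚ → ℚ → ℚ × ℚ) (fl : ℚ → ℚ)
    (p₁ p₂ p₃ q₁ q₂ q₃ r₁ r₂ r₃ s₁ s₂ s₃ : ℚ) : List ℚ :=
  fastExpansionSumZeroElim fl
    (fastExpansionSumZeroElim fl (insphereMinor3 tp fl p₁ p₂ p₃ q₁ q₂ q₃ r₁ r₂ r₃)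
      (insphereMinor3 tp fl p₁ p₂ p₃ r₁ r₂ r₃ s₁ s₂ s₃))
    (negComponents (fastExpansionSumZeroElim fl (insphereMinor3 tp fl q₁ q₂ q₃ r₁ r₂ r₃ s₁ s₂ s₃)
      (insphereMinor3 tp fl p₁ p₂ p₃ q₁ q₂ q₃ s₁ s₂ s₃)))

/-- A lifted cofactor `((m ⊗ x) ⊗ s ⊞ (m ⊗ y) ⊗ t) ⊞ (m ⊗ z) ⊗ u` — value `m·(xs + yt + zu)`, i.e.
`±|a|²·m` for `(x, y, z) = (a₁, a₂, a₃)` and `(s, t, u) = ±(a₁, a₂, a₃)` (≤ 1152 components). -/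
def insphereLift (tp : ℚ → ℚ → ℚ × ℚ) (fl : ℚ → ℚ) (m : List ℚ) (x y z s t u : ℚ) : List ℚ :=
  fastExpansionSumZeroElim fl
    (fastExpansionSumZeroElim fl
      (scaleExpansionZeroElim tp fl (scaleExpansionZeroElim tp fl m x) s)
      (scaleExpansionZeroElim tp fl (scaleExpansionZeroElim tp fl m y) t))
    (scaleExpansionZeroElim tp fl (scaleExpansionZeroElim tp fl m z) u)

/-- **INSPHERE EXACTLY**: `deter = ((L_a ⊞ L_b) ⊞ (L_c ⊞ L_d)) ⊞ L_e` with
`L_a = −|a|²·N(b, c, d, e)`, `L_b = |b|²·N(a, c, d, e)`, `L_c = −|c|²·N(a, b, d, e)`,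
`L_d = |d|²·N(a, b, c, e)`, `L_e = −|e|²·N(a, b, c, d)` (≤ 5760 components; the answer is the sign
of the last one). -/
def insphereExact (tp : ℚ → ℚ → ℚ × ℚ) (fl : ℚ → ℚ)
    (a₁ a₂ a₃ b₁ b₂ b₃ c₁ c₂ c₃ d₁ d₂ d₃ e₁ e₂ e₃ : ℚ) : List ℚ :=
  fastExpansionSumZeroElim fl
    (fastExpansionSumZeroElim fl
      (fastExpansionSumZeroElim fl
        (insphereLift tp fl (insphereMinor4 tp fl b₁ b₂ b₃ c₁ c₂ c₃ d₁ d₂ d₃ e₁ e₂ e₃)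
          a₁ a₂ a₃ (-a₁) (-a₂) (-a₃))
        (insphereLift tp fl (insphereMinor4 tp fl a₁ a₂ a₃ c₁ c₂ c₃ d₁ d₂ d₃ e₁ e₂ e₃)
          b₁ b₂ b₃ b₁ b₂ b₃))
      (fastExpansionSumZeroElim fl
        (insphereLift tp fl (insphereMinor4 tp fl a₁ a₂ a₃ b₁ b₂ b₃ d₁ d₂ d₃ e₁ e₂ e₃)
          c₁ c₂ c₃ (-c₁) (-c₂) (-c₃))
        (insphereLift tp fl (insphereMinor4 tp fl a₁ a₂ a₃ b₁ b₂ b₃ c₁ c₂ c₃ e₁ e₂ e₃)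
          d₁ d₂ d₃ d₁ d₂ d₃)))
    (insphereLift tp fl (insphereMinor4 tp fl a₁ a₂ a₃ b₁ b₂ b₃ c₁ c₂ c₃ d₁ d₂ d₃)
      e₁ e₂ e₃ (-e₁) (-e₂) (-e₃))

/-! ## The levels carry the invariant -/

section
variable (hp : 4 ≤ p) (hfl : IsRoundNearest p emin fl) (hfl2 : RoundoffBelow 2 fl) {e₀ : ℤ}
  (h2 : emin ≤ e₀ + e₀) (h3 : emin ≤ e₀ + e₀ + e₀) (h4 : emin ≤ e₀ + e₀ + e₀ + e₀)
  (h5 : emin ≤ e₀ + e₀ + e₀ + e₀ + e₀) {tp : ℚ → ℚ → ℚ × ℚ}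
  (htp : ∀ x y, IsFloat p e₀ x → IsFloat p e₀ y → ExactTwoProd p emin fl tp x y)
  (htp₂ : ∀ x y, IsFloat p (e₀ + e₀) x → IsFloat p e₀ y → ExactTwoProd p emin fl tp x y)
  (htp₃ : ∀ x y, IsFloat p (e₀ + e₀ + e₀) x → IsFloat p e₀ y → ExactTwoProd p emin fl tp x y)
  (htp₄ : ∀ x y, IsFloat p (e₀ + e₀ + e₀ + e₀) x → IsFloat p e₀ y →
    ExactTwoProd p emin fl tp x y)
include hp hfl hfl2 h2 h3 htp htp₂

/-- `T(p, q, r)`: at most 24 components on `F(p, 3e₀)`, class W, exact value. -/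
theorem exactW_insphereMinor3 {p₁ p₂ p₃ q₁ q₂ q₃ r₁ r₂ r₃ : ℚ} (hp₁ : IsFloat p e₀ p₁)
    (hp₂ : IsFloat p e₀ p₂) (hp₃ : IsFloat p e₀ p₃) (hq₁ : IsFloat p e₀ q₁)
    (hq₂ : IsFloat p e₀ q₂) (hq₃ : IsFloat p e₀ q₃) (hr₁ : IsFloat p e₀ r₁)
    (hr₂ : IsFloat p e₀ r₂) (hr₃ : IsFloat p e₀ r₃) :
    ExactW p emin (e₀ + e₀ + e₀) 24 (xyzDet3 p₁ p₂ p₃ q₁ q₂ q₃ r₁ r₂ r₃)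
      (insphereMinor3 tp fl p₁ p₂ p₃ q₁ q₂ q₃ r₁ r₂ r₃) := by
  have hp1 : 1 ≤ p := le_trans (by norm_num) hp
  have S : ∀ {a b c d z : ℚ}, IsFloat p e₀ a → IsFloat p e₀ b → IsFloat p e₀ c →
      IsFloat p e₀ d → IsFloat p e₀ z → ExactW p emin (e₀ + e₀ + e₀) 8 ((a * b - c * d) * z)
        (scaleExpansionZeroElim tp fl (twoTwoProdDiff tp fl a b c d) z) :=
    fun ha hb hc hd hz => exactW_scale_coarse hp1 hfl hfl2 h3 htp₂
      (exactW_block hp1 hfl hfl2 h2 htp ha hb hc hd) hz (by norm_num) (by norm_num) rfl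
  have X := exactW_fesze hp hfl hfl2 h3 (S hq₁ hr₂ hr₁ hq₂ hp₃) (S hp₁ hr₂ hr₁ hp₂ hq₃.neg)
    (n := 16) (by norm_num) (by norm_num) rfl
  exact exactW_fesze hp hfl hfl2 h3 X (S hp₁ hq₂ hq₁ hp₂ hr₃) (n := 24) (by norm_num) (by norm_num)
    (by unfold xyzDet3; ring)

/-- `N(p, q, r, s)`: at most 96 components on `F(p, 3e₀)`, class W, value the `4 × 4` determinant
of the rows `(x, y, z, 1)`, i.e. `T(pqr) + T(prs) − T(qrs) − T(pqs)`. -/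
theorem exactW_insphereMinor4 {p₁ p₂ p₃ q₁ q₂ q₃ r₁ r₂ r₃ s₁ s₂ s₃ : ℚ} (hp₁ : IsFloat p e₀ p₁)
    (hp₂ : IsFloat p e₀ p₂) (hp₃ : IsFloat p e₀ p₃) (hq₁ : IsFloat p e₀ q₁)
    (hq₂ : IsFloat p e₀ q₂) (hq₃ : IsFloat p e₀ q₃) (hr₁ : IsFloat p e₀ r₁)
    (hr₂ : IsFloat p e₀ r₂) (hr₃ : IsFloat p e₀ r₃) (hs₁ : IsFloat p e₀ s₁)
    (hs₂ : IsFloat p e₀ s₂) (hs₃ : IsFloat p e₀ s₃) :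
    ExactW p emin (e₀ + e₀ + e₀) 96
      (xyzDet3 p₁ p₂ p₃ q₁ q₂ q₃ r₁ r₂ r₃ + xyzDet3 p₁ p₂ p₃ r₁ r₂ r₃ s₁ s₂ s₃
        - (xyzDet3 q₁ q₂ q₃ r₁ r₂ r₃ s₁ s₂ s₃ + xyzDet3 p₁ p₂ p₃ q₁ q₂ q₃ s₁ s₂ s₃))
      (insphereMinor4 tp fl p₁ p₂ p₃ q₁ q₂ q₃ r₁ r₂ r₃ s₁ s₂ s₃) := by
  have T : ∀ {p₁ p₂ p₃ q₁ q₂ q₃ r₁ r₂ r₃ : ℚ}, IsFloat p e₀ p₁ → IsFloat p e₀ p₂ →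
      IsFloat p e₀ p₃ → IsFloat p e₀ q₁ → IsFloat p e₀ q₂ → IsFloat p e₀ q₃ → IsFloat p e₀ r₁ →
      IsFloat p e₀ r₂ → IsFloat p e₀ r₃ → ExactW p emin (e₀ + e₀ + e₀) 24
        (xyzDet3 p₁ p₂ p₃ q₁ q₂ q₃ r₁ r₂ r₃) (insphereMinor3 tp fl p₁ p₂ p₃ q₁ q₂ q₃ r₁ r₂ r₃) :=
    fun h₁ h₂ h₃ h₄ h₅ h₆ h₇ h₈ h₉ =>
      exactW_insphereMinor3 hp hfl hfl2 h2 h3 htp htp₂ h₁ h₂ h₃ h₄ h₅ h₆ h₇ h₈ h₉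
  have P := exactW_fesze hp hfl hfl2 h3 (T hp₁ hp₂ hp₃ hq₁ hq₂ hq₃ hr₁ hr₂ hr₃)
    (T hp₁ hp₂ hp₃ hr₁ hr₂ hr₃ hs₁ hs₂ hs₃) (n := 48) (by norm_num) (by norm_num) rfl
  have M := exactW_fesze hp hfl hfl2 h3 (T hq₁ hq₂ hq₃ hr₁ hr₂ hr₃ hs₁ hs₂ hs₃)
    (T hp₁ hp₂ hp₃ hq₁ hq₂ hq₃ hs₁ hs₂ hs₃) (n := 48) (by norm_num) (by norm_num) rfl
  exact exactW_fesze hp hfl hfl2 h3 P (exactW_neg M) (n := 96) (by norm_num) (by norm_num)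
    (by ring)

include h4 h5 htp₃ htp₄

omit h2 h3 htp htp₂ in
/-- A lifted cofactor: at most 1152 components on `F(p, 5e₀)`, class W, value
`v·(xs + yt + zu)`. -/
theorem exactW_insphereLift {v : ℚ} {m : List ℚ} (hm : ExactW p emin (e₀ + e₀ + e₀) 96 v m)
    {x y z s t u : ℚ} (hx : IsFloat p e₀ x) (hy : IsFloat p e₀ y) (hz : IsFloat p e₀ z)
    (hs : IsFloat p e₀ s) (ht : IsFloat p e₀ t) (hu : IsFloat p e₀ u) :
    ExactW p emin (e₀ + e₀ + e₀ + e₀ + e₀) 1152 (v * (x * s + y * t + z * u))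
      (insphereLift tp fl m x y z s t u) := by
  have hp1 : 1 ≤ p := le_trans (by norm_num) hp
  have L : ∀ {x s : ℚ}, IsFloat p e₀ x → IsFloat p e₀ s →
      ExactW p emin (e₀ + e₀ + e₀ + e₀ + e₀) 384 (v * x * s)
        (scaleExpansionZeroElim tp fl (scaleExpansionZeroElim tp fl m x) s) :=
    fun hx hs => exactW_scale_coarse hp1 hfl hfl2 h5 htp₄
      (exactW_scale_coarse hp1 hfl hfl2 h4 htp₃ hm hx (n' := 192) (by norm_num) (by norm_num)
        rfl) hs (by norm_num) (by norm_num) rfl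
  have XY := exactW_fesze hp hfl hfl2 h5 (L hx hs) (L hy ht) (n := 768) (by norm_num)
    (by norm_num) rfl
  exact exactW_fesze hp hfl hfl2 h5 XY (L hz hu) (n := 1152) (by norm_num) (by norm_num)
    (by ring)

/-- **THEOREM (INSPHERE's exact routine computes an exact W-expansion of the determinant).**
`insphereExact` is a NONEMPTY weakly nonoverlapping expansion of at most 5760 floats, all nonzero
unless it is `⟨0⟩`, whose sum is `insphereDet` EXACTLY (hypotheses as in the module docstring:
`p ≥ 4`, `RoundoffBelow 2` round-to-nearest, error-free two-products on `F(p, ke₀) × F(p, e₀)`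
for `k ≤ 4`, coordinates in `F(p, e₀)` with `ke₀ ≥ emin` for `2 ≤ k ≤ 5`). -/
theorem insphereExact_spec {a₁ a₂ a₃ b₁ b₂ b₃ c₁ c₂ c₃ d₁ d₂ d₃ e₁ e₂ e₃ : ℚ}
    (ha₁ : IsFloat p e₀ a₁) (ha₂ : IsFloat p e₀ a₂) (ha₃ : IsFloat p e₀ a₃)
    (hb₁ : IsFloat p e₀ b₁) (hb₂ : IsFloat p e₀ b₂) (hb₃ : IsFloat p e₀ b₃)
    (hc₁ : IsFloat p e₀ c₁) (hc₂ : IsFloat p e₀ c₂) (hc₃ : IsFloat p e₀ c₃)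
    (hd₁ : IsFloat p e₀ d₁) (hd₂ : IsFloat p e₀ d₂) (hd₃ : IsFloat p e₀ d₃)
    (he₁ : IsFloat p e₀ e₁) (he₂ : IsFloat p e₀ e₂) (he₃ : IsFloat p e₀ e₃) :
    IsWeakExpansion (insphereExact tp fl a₁ a₂ a₃ b₁ b₂ b₃ c₁ c₂ c₃ d₁ d₂ d₃ e₁ e₂ e₃) ∧
      (insphereExact tp fl a₁ a₂ a₃ b₁ b₂ b₃ c₁ c₂ c₃ d₁ d₂ d₃ e₁ e₂ e₃).sum =
        insphereDet a₁ a₂ a₃ b₁ b₂ b₃ c₁ c₂ c₃ d₁ d₂ d₃ e₁ e₂ e₃ ∧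
      (∀ x ∈ insphereExact tp fl a₁ a₂ a₃ b₁ b₂ b₃ c₁ c₂ c₃ d₁ d₂ d₃ e₁ e₂ e₃,
        IsFloat p emin x) ∧
      insphereExact tp fl a₁ a₂ a₃ b₁ b₂ b₃ c₁ c₂ c₃ d₁ d₂ d₃ e₁ e₂ e₃ ≠ [] ∧
      ((∀ x ∈ insphereExact tp fl a₁ a₂ a₃ b₁ b₂ b₃ c₁ c₂ c₃ d₁ d₂ d₃ e₁ e₂ e₃, x ≠ 0) ∨
        insphereExact tp fl a₁ a₂ a₃ b₁ b₂ b₃ c₁ c₂ c₃ d₁ d₂ d₃ e₁ e₂ e₃ = [0]) ∧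
      (insphereExact tp fl a₁ a₂ a₃ b₁ b₂ b₃ c₁ c₂ c₃ d₁ d₂ d₃ e₁ e₂ e₃).length ≤ 5760 := by
  have N : ∀ {p₁ p₂ p₃ q₁ q₂ q₃ r₁ r₂ r₃ s₁ s₂ s₃ : ℚ}, IsFloat p e₀ p₁ → IsFloat p e₀ p₂ →
      IsFloat p e₀ p₃ → IsFloat p e₀ q₁ → IsFloat p e₀ q₂ → IsFloat p e₀ q₃ → IsFloat p e₀ r₁ →
      IsFloat p e₀ r₂ → IsFloat p e₀ r₃ → IsFloat p e₀ s₁ → IsFloat p e₀ s₂ → IsFloat p e₀ s₃ →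
      ExactW p emin (e₀ + e₀ + e₀) 96
        (xyzDet3 p₁ p₂ p₃ q₁ q₂ q₃ r₁ r₂ r₃ + xyzDet3 p₁ p₂ p₃ r₁ r₂ r₃ s₁ s₂ s₃
          - (xyzDet3 q₁ q₂ q₃ r₁ r₂ r₃ s₁ s₂ s₃ + xyzDet3 p₁ p₂ p₃ q₁ q₂ q₃ s₁ s₂ s₃))
        (insphereMinor4 tp fl p₁ p₂ p₃ q₁ q₂ q₃ r₁ r₂ r₃ s₁ s₂ s₃) :=
    fun g₁ g₂ g₃ g₄ g₅ g₆ g₇ g₈ g₉ g₁₀ g₁₁ g₁₂ => exactW_insphereMinor4 hp hfl hfl2 h2 h3 htp htp₂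
      g₁ g₂ g₃ g₄ g₅ g₆ g₇ g₈ g₉ g₁₀ g₁₁ g₁₂
  have L : ∀ {v : ℚ} {m : List ℚ}, ExactW p emin (e₀ + e₀ + e₀) 96 v m →
      ∀ {x y z s t u : ℚ}, IsFloat p e₀ x → IsFloat p e₀ y → IsFloat p e₀ z → IsFloat p e₀ s →
      IsFloat p e₀ t → IsFloat p e₀ u → ExactW p emin (e₀ + e₀ + e₀ + e₀ + e₀) 1152
        (v * (x * s + y * t + z * u)) (insphereLift tp fl m x y z s t u) :=
    fun hm _ _ _ _ _ _ hx hy hz hs ht hu =>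
      exactW_insphereLift hp hfl hfl2 h4 h5 htp₃ htp₄ hm hx hy hz hs ht hu
  have La := L (N hb₁ hb₂ hb₃ hc₁ hc₂ hc₃ hd₁ hd₂ hd₃ he₁ he₂ he₃)
    ha₁ ha₂ ha₃ ha₁.neg ha₂.neg ha₃.neg
  have Lb := L (N ha₁ ha₂ ha₃ hc₁ hc₂ hc₃ hd₁ hd₂ hd₃ he₁ he₂ he₃) hb₁ hb₂ hb₃ hb₁ hb₂ hb₃
  have Lc := L (N ha₁ ha₂ ha₃ hb₁ hb₂ hb₃ hd₁ hd₂ hd₃ he₁ he₂ he₃)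
    hc₁ hc₂ hc₃ hc₁.neg hc₂.neg hc₃.neg
  have Ld := L (N ha₁ ha₂ ha₃ hb₁ hb₂ hb₃ hc₁ hc₂ hc₃ he₁ he₂ he₃) hd₁ hd₂ hd₃ hd₁ hd₂ hd₃
  have Le := L (N ha₁ ha₂ ha₃ hb₁ hb₂ hb₃ hc₁ hc₂ hc₃ hd₁ hd₂ hd₃)
    he₁ he₂ he₃ he₁.neg he₂.neg he₃.neg
  have AB := exactW_fesze hp hfl hfl2 h5 La Lb (n := 2304) (by norm_num) (by norm_num) rfl
  have CD := exactW_fesze hp hfl hfl2 h5 Lc Ld (n := 2304) (by norm_num) (by norm_num) rfl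
  have ABCD := exactW_fesze hp hfl hfl2 h5 AB CD (n := 4608) (by norm_num) (by norm_num) rfl
  have D := exactW_fesze hp hfl hfl2 h5 ABCD Le (n := 5760) (by norm_num) (by norm_num) rfl
  obtain ⟨-, -, -, Nz, Z, -⟩ :=
    fastExpansionSumZeroElim_spec hp hfl hfl2 ABCD.float ABCD.weak Le.float Le.weak
  refine ⟨D.weak, ?_, D.float, Nz, Z, D.length_le⟩
  unfold insphereExact
  rw [D.sum_eq]
  unfold insphereDet xyzDet3
  ring

/-- **The sign of the INSPHERE determinant from the exact expansion**: the LAST component of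
`insphereExact` decides `det > 0`, `det < 0`, and `det = 0 ↔ insphereExact = ⟨0⟩`. -/
theorem insphereExact_sign {a₁ a₂ a₃ b₁ b₂ b₃ c₁ c₂ c₃ d₁ d₂ d₃ e₁ e₂ e₃ : ℚ}
    (ha₁ : IsFloat p e₀ a₁) (ha₂ : IsFloat p e₀ a₂) (ha₃ : IsFloat p e₀ a₃)
    (hb₁ : IsFloat p e₀ b₁) (hb₂ : IsFloat p e₀ b₂) (hb₃ : IsFloat p e₀ b₃)
    (hc₁ : IsFloat p e₀ c₁) (hc₂ : IsFloat p e₀ c₂) (hc₃ : IsFloat p e₀ c₃)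
    (hd₁ : IsFloat p e₀ d₁) (hd₂ : IsFloat p e₀ d₂) (hd₃ : IsFloat p e₀ d₃)
    (he₁ : IsFloat p e₀ e₁) (he₂ : IsFloat p e₀ e₂) (he₃ : IsFloat p e₀ e₃) :
    ∃ hD : insphereExact tp fl a₁ a₂ a₃ b₁ b₂ b₃ c₁ c₂ c₃ d₁ d₂ d₃ e₁ e₂ e₃ ≠ [],
      (0 < insphereDet a₁ a₂ a₃ b₁ b₂ b₃ c₁ c₂ c₃ d₁ d₂ d₃ e₁ e₂ e₃ ↔
          0 < (insphereExact tp fl a₁ a₂ a₃ b₁ b₂ b₃ c₁ c₂ c₃ d₁ d₂ d₃ e₁ e₂ e₃).getLast hD) ∧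
        (insphereDet a₁ a₂ a₃ b₁ b₂ b₃ c₁ c₂ c₃ d₁ d₂ d₃ e₁ e₂ e₃ < 0 ↔
          (insphereExact tp fl a₁ a₂ a₃ b₁ b₂ b₃ c₁ c₂ c₃ d₁ d₂ d₃ e₁ e₂ e₃).getLast hD < 0) ∧
        (insphereDet a₁ a₂ a₃ b₁ b₂ b₃ c₁ c₂ c₃ d₁ d₂ d₃ e₁ e₂ e₃ = 0 ↔
          insphereExact tp fl a₁ a₂ a₃ b₁ b₂ b₃ c₁ c₂ c₃ d₁ d₂ d₃ e₁ e₂ e₃ = [0]) := by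
  obtain ⟨hW, hS, hF, hne, hZ, -⟩ := insphereExact_spec hp hfl hfl2 h2 h3 h4 h5 htp htp₂ htp₃
    htp₄ ha₁ ha₂ ha₃ hb₁ hb₂ hb₃ hc₁ hc₂ hc₃ hd₁ hd₂ hd₃ he₁ he₂ he₃
  refine ⟨hne, ?_⟩
  rw [← hS]
  rcases hZ with hnz | h0
  · obtain ⟨s₁, s₂, s₃⟩ :=
      sign_sum_of_getLast_ne_zero hF hW.isExpansion hne (hnz _ (List.getLast_mem hne))
    refine ⟨s₁, s₂, ⟨fun h => absurd h s₃, fun h => ?_⟩⟩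
    exfalso
    rw [h] at hnz
    exact hnz 0 (List.mem_singleton_self 0) rfl
  · have key : ∀ (L : List ℚ) (h : L ≠ []), L = [0] → L.getLast h = 0 ∧ L.sum = 0 := by
      rintro L h rfl; exact ⟨rfl, by simp⟩
    obtain ⟨hl, hs0⟩ := key _ hne h0
    rw [hl, hs0]
    exact ⟨Iff.rfl, Iff.rfl, ⟨fun _ => h0, fun _ => rfl⟩⟩

end

/-! ## IEEE round-to-nearest-even with the FMA two-product -/

/-- INSPHERE's exact routine as run on a round-to-nearest-even machine with the FMA two-product,
precision `p`, underflow threshold `emin`. -/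
def insphereExactRNE (p : ℕ) (emin : ℤ)
    (a₁ a₂ a₃ b₁ b₂ b₃ c₁ c₂ c₃ d₁ d₂ d₃ e₁ e₂ e₃ : ℚ) : List ℚ :=
  insphereExact (twoProdFMA (roundTiesEven p emin)) (roundTiesEven p emin)
    a₁ a₂ a₃ b₁ b₂ b₃ c₁ c₂ c₃ d₁ d₂ d₃ e₁ e₂ e₃

/-- **INSPHERE's exact routine IS CORRECT ON AN IEEE MACHINE** (round-to-nearest-even, FMA
two-product, `p ≥ 4`): for coordinates in `F(p, e₀)` with `emin ≤ ke₀`, `k = 2, …, 5` (binary64: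
all fifteen coordinates multiples of `2^−214`), `Σ = insphereDet` exactly and the last component
carries the sign, with `det = 0 ↔ ⟨0⟩`. -/
theorem insphereExactRNE_correct (hp : 4 ≤ p) {e₀ : ℤ} (h2 : emin ≤ e₀ + e₀)
    (h3 : emin ≤ e₀ + e₀ + e₀) (h4 : emin ≤ e₀ + e₀ + e₀ + e₀)
    (h5 : emin ≤ e₀ + e₀ + e₀ + e₀ + e₀) {a₁ a₂ a₃ b₁ b₂ b₃ c₁ c₂ c₃ d₁ d₂ d₃ e₁ e₂ e₃ : ℚ}
    (ha₁ : IsFloat p e₀ a₁) (ha₂ : IsFloat p e₀ a₂) (ha₃ : IsFloat p e₀ a₃)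
    (hb₁ : IsFloat p e₀ b₁) (hb₂ : IsFloat p e₀ b₂) (hb₃ : IsFloat p e₀ b₃)
    (hc₁ : IsFloat p e₀ c₁) (hc₂ : IsFloat p e₀ c₂) (hc₃ : IsFloat p e₀ c₃)
    (hd₁ : IsFloat p e₀ d₁) (hd₂ : IsFloat p e₀ d₂) (hd₃ : IsFloat p e₀ d₃)
    (he₁ : IsFloat p e₀ e₁) (he₂ : IsFloat p e₀ e₂) (he₃ : IsFloat p e₀ e₃) :
    (insphereExactRNE p emin a₁ a₂ a₃ b₁ b₂ b₃ c₁ c₂ c₃ d₁ d₂ d₃ e₁ e₂ e₃).sum =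
        insphereDet a₁ a₂ a₃ b₁ b₂ b₃ c₁ c₂ c₃ d₁ d₂ d₃ e₁ e₂ e₃ ∧
      ∃ hD : insphereExactRNE p emin a₁ a₂ a₃ b₁ b₂ b₃ c₁ c₂ c₃ d₁ d₂ d₃ e₁ e₂ e₃ ≠ [],
        (0 < insphereDet a₁ a₂ a₃ b₁ b₂ b₃ c₁ c₂ c₃ d₁ d₂ d₃ e₁ e₂ e₃ ↔
            0 < (insphereExactRNE p emin a₁ a₂ a₃ b₁ b₂ b₃ c₁ c₂ c₃ d₁ d₂ d₃ e₁ e₂ e₃).getLast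
              hD) ∧
          (insphereDet a₁ a₂ a₃ b₁ b₂ b₃ c₁ c₂ c₃ d₁ d₂ d₃ e₁ e₂ e₃ < 0 ↔
            (insphereExactRNE p emin a₁ a₂ a₃ b₁ b₂ b₃ c₁ c₂ c₃ d₁ d₂ d₃ e₁ e₂ e₃).getLast
              hD < 0) ∧
          (insphereDet a₁ a₂ a₃ b₁ b₂ b₃ c₁ c₂ c₃ d₁ d₂ d₃ e₁ e₂ e₃ = 0 ↔
            insphereExactRNE p emin a₁ a₂ a₃ b₁ b₂ b₃ c₁ c₂ c₃ d₁ d₂ d₃ e₁ e₂ e₃ = [0]) := by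
  have hp1 : 1 ≤ p := le_trans (by norm_num) hp
  have hfl : IsRoundNearest p emin (roundTiesEven p emin) := isRoundNearest_roundTiesEven hp1
  have hfl2 : RoundoffBelow 2 (roundTiesEven p emin) := roundoffBelow_two_roundTiesEven p emin
  have T : ∀ {g : ℤ}, emin ≤ g + e₀ → ∀ x y, IsFloat p g x → IsFloat p e₀ y →
      ExactTwoProd p emin (roundTiesEven p emin) (twoProdFMA (roundTiesEven p emin)) x y :=
    fun h x y hx hy => exactTwoProd_twoProdFMA₂ hp1 hfl h hx hy
  obtain ⟨-, hS, -, -, -, -⟩ := insphereExact_spec hp hfl hfl2 h2 h3 h4 h5 (T h2) (T h3) (T h4)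
    (T h5) ha₁ ha₂ ha₃ hb₁ hb₂ hb₃ hc₁ hc₂ hc₃ hd₁ hd₂ hd₃ he₁ he₂ he₃
  exact ⟨hS, insphereExact_sign hp hfl hfl2 h2 h3 h4 h5 (T h2) (T h3) (T h4) (T h5)
    ha₁ ha₂ ha₃ hb₁ hb₂ hb₃ hc₁ hc₂ hc₃ hd₁ hd₂ hd₃ he₁ he₂ he₃⟩

end Summit.Ventures.CertifiedArithmetic.Expansions
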